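import Literature.Topology.FourManifolds.SlabLevelRetraction
import Literature.Topology.FourManifolds.MilnorBoxDynamics
import Literature.Topology.FourManifolds.MilnorChartIndex
import Literature.Topology.FourManifolds.LeftHandSphereLocal
import Mathlib.Analysis.Calculus.ContDiff.WithLp
import HarnessLib

/-!
# The unstable sets above a level are thin, and the slab is joined to its lower part
# (Milnor 1965, Def. 3.9 and Thm. 3.14 read through general position)

Topic `Literature/Topology/FourManifolds` (fact seat
`provefact-Literature.Topology.FourManifolds.Cobord-79c3e8bec0`, proof of the named fact
`Literature.Topology.FourManifolds.Cobordism.Milnor1965_simplyConnected_levels`; companion of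
`SlabLevelRetraction.lean`).  Milnor, *Lectures on the h-cobordism theorem* (1965), Def. 3.9
(PDF p. 16 of the held copy): the right-hand disc `D_R` of a critical point `p` is *"the union of
segments of integral curves of `ξ` beginning at `p`"*, an `(n - λ)`-disc; proof of Thm. 3.12
(PDF p. 18): in the coordinates of Def. 3.1 (2), `f = f(p) - |x⃗|² + |y⃗|²`, `ξ = (-x⃗, y⃗)`,
*"If `x⃗` or `y⃗` is zero this trajectory is a straight line segment tending to the
origin"* — the local unstable disc is the `y⃗`-plane `{x⃗ = 0}`.

For the slab flow `θ` of a cobordism (`Literature.Topology.FourManifolds.Cobordism.SlabFlow`) we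
prove:

* `MilnorBox.exists_smooth_param_unstableDisc` — the local unstable disc `{x⃗ = 0, |y⃗|² < 4ε²}` of
  a Milnor box of index `k` is covered by the image of a `C^∞` map from an open subset of `ℝᵈ`,
  `d ≥ m - k` (the inverse chart on the `y⃗`-plane);
* `SlabFlow.exists_thin_cover_obstruction` — **the obstruction set above a regular level `b`
  is thin**: the set of slab points above `b` lying on the unstable set of a critical point `p`
  with `b < f p` (the set off which the slab flows down onto the level `b`,
  `SlabLevelRetraction.lean`) is covered by countably many `C¹` images of open subsets of
  `ℝᵈ`, `d ≥ (n + 1) - index`, namely the flow images `θ(j, ·)`, `j ∈ ℕ`, of the local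
  unstable discs (every trajectory coming from `p` was in the box of `p` on its unstable disc,
  `MilnorBoxDynamics.lean`) — the general-position input "`D_R(p)` has dimension
  `n + 1 - λ`" of Milnor's cell argument (Remark 1 after Thm. 6.4, PDF p. 38; proof of
  Thm. 8.1, PDF p. 56);
* `SlabFlow.exists_joinedIn_lowerSlab` — **every point of the slab `f⁻¹[lo, t₂]` is joined
  inside it to a point of the lower part `f⁻¹[lo, t₁]`** when the critical points between the
  levels `t₁ < t₂` have nonzero index: flow down; a point on an unstable set is joined along its
  trajectory and the unstable disc to the critical point, which is joined along its stable disc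
  to a point strictly below it (induction on the number of critical values below the point).

Everything is proved; no definitions.

## References

* J. Milnor, *Lectures on the h-cobordism theorem*, notes by L. Siebenmann and J. Sondow,
  Princeton Mathematical Notes (1965), Def. 3.1, Def. 3.9, proof of Thm. 3.12, Thm. 3.14,
  Thm. 4.1 (PDF pp. 11–22), Remark 1 after Thm. 6.4 (PDF p. 38), proof of Thm. 8.1 (PDF
  p. 56).  Held: `lit read book:milnornd-lectures-h-cobordism-theorem`. [MilnorHCobordism1965]
-/

open scoped Manifold ContDiff Topology
open Set Function Filter

noncomputable section

namespace Literature.Topology.FourManifolds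

universe u

/-! ### Model computations -/

section Model

variable {m : ℕ}

/-- `|x⃗|² = 0` forces all contracting coordinates to vanish. [folklore] -/
theorem apply_eq_zero_of_sqSumLT_eq_zero {k : ℕ} {u : EuclideanSpace ℝ (Fin m)} (h : sqSumLT k u = 0)
    {i : Fin m} (hi : (i : ℕ) < k) : u i = 0 := by
  have h' := (Finset.sum_eq_zero_iff_of_nonneg (fun j _ => sq_nonneg (u j))).1 h i
    (Finset.mem_filter.2 ⟨Finset.mem_univ _, hi⟩)
  exact pow_eq_zero_iff two_ne_zero |>.1 h'

end Model

/-! ### Paths from maps on `[0, 1]` -/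

/-- A map continuous on `[0, 1]` with values in `S` joins its end points inside `S`. [folklore] -/
theorem joinedIn_of_continuousOn {X : Type*} [TopologicalSpace X] {S : Set X} {γ : ℝ → X}
    (hγ : ContinuousOn γ (Icc 0 1)) (hmem : ∀ s ∈ Icc (0 : ℝ) 1, γ s ∈ S) :
    JoinedIn S (γ 0) (γ 1) := by
  refine ⟨Path.ofLine hγ rfl rfl, fun t => ?_⟩
  obtain ⟨s, hs, hst⟩ := Path.ofLine_mem hγ rfl rfl t
  rw [← hst]
  exact hmem s hs

/-! ### The local unstable disc of a Milnor box is a smooth image of `ℝᵈ` -/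

namespace MilnorBox

variable {m : ℕ} {H : Type*} [TopologicalSpace H] {J : ModelWithCorners ℝ (EuclideanSpace ℝ (Fin m)) H}
  {M : Type u} [TopologicalSpace M] [ChartedSpace H M]
  {f : M → ℝ} {X : Π x : M, TangentSpace J x} {q : M}

/-- **The local unstable disc is a smooth image of `ℝᵈ`** (Milnor: in the coordinates of
Def. 3.1 (2) the trajectories coming from the critical point fill the `y⃗`-plane `{x⃗ = 0}`, a
disc of dimension `m - k`).  For a Milnor box `D` of index `k` and any `d ≥ m - k` there are an
open `O ⊆ ℝᵈ` and a map `G : ℝᵈ → M`, `C^∞` on `O`, whose image of `O` contains every point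
of the chart domain with `|x⃗|² = 0` and `|y⃗|² < 4ε²` (`G` is the inverse chart composed with
the linear embedding of `ℝᵈ` onto the `y⃗`-plane). [cite: MilnorHCobordism1965, Def. 3.1 (2) (PDF p. 12), Def. 3.9 (PDF p. 16), proof of Thm. 3.12 (PDF p. 18)] -/
theorem exists_smooth_param_unstableDisc [IsManifold J ∞ M] (D : MilnorBox J f X q) {d : ℕ}
    (hd : m ≤ d + D.k) :
    ∃ (O : Set (Fin d → ℝ)) (G : (Fin d → ℝ) → M), IsOpen O ∧
      ContMDiffOn 𝓘(ℝ, Fin d → ℝ) J ∞ G O ∧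
      ∀ z ∈ D.chart.source, sqSumLT D.k (D.coord z) = 0 →
        sqSumGE D.k (D.coord z) < 4 * D.ε ^ 2 → z ∈ G '' O := by
  classical
  -- the linear embedding of `ℝᵈ` onto the `y⃗`-plane
  set emb : (Fin d → ℝ) → EuclideanSpace ℝ (Fin m) := fun w => WithLp.toLp 2 fun i : Fin m =>
    if h : D.k ≤ (i : ℕ) ∧ (i : ℕ) - D.k < d then w ⟨(i : ℕ) - D.k, h.2⟩ else 0 with hemb_def
  have hemb_apply : ∀ w (i : Fin m), emb w i =
      if h : D.k ≤ (i : ℕ) ∧ (i : ℕ) - D.k < d then w ⟨(i : ℕ) - D.k, h.2⟩ else 0 := fun w i => rfl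
  have hemb : ContDiff ℝ ∞ emb := by
    refine contDiff_piLp' 2 fun i => ?_
    by_cases hc : D.k ≤ (i : ℕ) ∧ (i : ℕ) - D.k < d
    · simp only [hemb_apply, dif_pos hc]
      exact contDiff_apply ℝ ℝ (⟨(i : ℕ) - D.k, hc.2⟩ : Fin d)
    · simp only [hemb_apply, dif_neg hc]
      exact contDiff_const
  have hA : ∀ w, sqSumLT D.k (emb w) = 0 := by
    intro w
    refine Finset.sum_eq_zero fun i hi => ?_
    have hi' : (i : ℕ) < D.k := (Finset.mem_filter.1 hi).2
    have : ¬ (D.k ≤ (i : ℕ) ∧ (i : ℕ) - D.k < d) := fun h => absurd h.1 (not_le.2 hi')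
    simp only [hemb_apply, dif_neg this]; ring
  -- the inverse chart on the translated vectors
  set ψ : EuclideanSpace ℝ (Fin m) → M := fun v => (D.chart.extend J).symm (D.chart.extend J q + v)
    with hψ_def
  have htgt : (D.chart.extend J).target = J '' D.chart.target := by
    rw [D.chart.extend_target, J.image_eq]
  have hψ : ContMDiffOn 𝓘(ℝ, EuclideanSpace ℝ (Fin m)) J ∞ ψ
      {v | D.chart.extend J q + v ∈ (D.chart.extend J).target} := by
    refine (contMDiffOn_extend_symm D.mem_maximalAtlas).comp
      (contMDiff_const.add contMDiff_id).contMDiffOn fun v hv => ?_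
    rw [← htgt]; exact hv
  set O : Set (Fin d → ℝ) := {w | sqSumGE D.k (emb w) < 4 * D.ε ^ 2} with hO_def
  have hO : IsOpen O := isOpen_lt ((continuous_sqSumGE D.k).comp hemb.continuous) continuous_const
  have hOt : ∀ w ∈ O, D.chart.extend J q + emb w ∈ (D.chart.extend J).target := fun w hw =>
    D.add_mem_target (by rw [hA]; exact sq_nonneg _) hw.le
  refine ⟨O, fun w => ψ (emb w), hO, hψ.comp hemb.contMDiff.contMDiffOn hOt, ?_⟩
  -- the covering
  intro z hz hzA hzB
  set v := D.coord z with hv_def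
  set w : Fin d → ℝ := fun j => if h : D.k + (j : ℕ) < m then v ⟨D.k + j, h⟩ else 0 with hw_def
  have hwv : emb w = v := by
    ext i
    rw [hemb_apply]
    by_cases hk : D.k ≤ (i : ℕ)
    · have hlt : (i : ℕ) - D.k < d := by have := i.2; omega
      rw [dif_pos ⟨hk, hlt⟩]
      have hsum : D.k + ((i : ℕ) - D.k) = i := by omega
      have hm : D.k + ((⟨(i : ℕ) - D.k, hlt⟩ : Fin d) : ℕ) < m := by
        change D.k + ((i : ℕ) - D.k) < m; rw [hsum]; exact i.2
      rw [hw_def]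
      simp only
      rw [dif_pos hm]
      have hfin : (⟨D.k + ((i : ℕ) - D.k), hm⟩ : Fin m) = i := Fin.ext hsum
      rw [hfin]
    · have : ¬ (D.k ≤ (i : ℕ) ∧ (i : ℕ) - D.k < d) := fun h => hk h.1
      rw [dif_neg this]
      exact (apply_eq_zero_of_sqSumLT_eq_zero hzA (not_le.1 hk)).symm
  refine ⟨w, ?_, ?_⟩
  · change sqSumGE D.k (emb w) < 4 * D.ε ^ 2
    rw [hwv]; exact hzB
  · change ψ (emb w) = z
    rw [hwv]
    exact D.symm_add_coord hz

/-- **`f` along a ray of the chart**: for a vector `v` of the closed model box and `s ∈ [0, 1]`,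
the point `ψ (s v)` lies in the chart domain with `f (ψ (s v)) = f q - s² |x⃗(v)|² + s² |y⃗(v)|²`.
[cite: MilnorHCobordism1965, Def. 3.1 (2) (PDF p. 12)] -/
theorem apply_symm_add_smul (D : MilnorBox J f X q) {v : EuclideanSpace ℝ (Fin m)}
    (h₁ : sqSumLT D.k v ≤ D.ε ^ 2) (h₂ : sqSumGE D.k v ≤ 4 * D.ε ^ 2) {s : ℝ} (hs : s ∈ Icc (0 : ℝ) 1) :
    (D.chart.extend J).symm (D.chart.extend J q + s • v) ∈ D.chart.source ∧
      f ((D.chart.extend J).symm (D.chart.extend J q + s • v)) =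
        f q - s ^ 2 * sqSumLT D.k v + s ^ 2 * sqSumGE D.k v := by
  have hs2 : s ^ 2 ≤ 1 := by nlinarith [hs.1, hs.2]
  have h₁' : sqSumLT D.k (s • v) ≤ D.ε ^ 2 := by
    rw [sqSumLT_smul]; nlinarith [sqSumLT_nonneg D.k v, sq_nonneg s]
  have h₂' : sqSumGE D.k (s • v) ≤ 4 * D.ε ^ 2 := by
    rw [sqSumGE_smul]; nlinarith [sqSumGE_nonneg D.k v, sq_nonneg s]
  have hnorm : ‖s • v‖ ≤ 3 * D.ε := D.norm_le_of_sq_le h₁' h₂'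
  refine ⟨D.symm_add_mem_source hnorm, ?_⟩
  rw [D.apply_eq _ (D.symm_add_mem_source hnorm)]
  change f q + milnorQuadratic D.k (D.coord ((D.chart.extend J).symm (D.chart.extend J q + s • v))) = _
  rw [D.coord_symm_add hnorm, milnorQuadratic_eq, sqSumLT_smul, sqSumGE_smul]
  ring

/-- **The rays of the chart are paths**: for `v` in the closed model box, the map
`s ↦ ψ (s v)` is continuous on `[0, 1]`, starts at `q` and ends at `ψ v`. [cite: MilnorHCobordism1965, proof of Thm. 3.12 (PDF p. 18)] -/
theorem continuousOn_symm_add_smul (D : MilnorBox J f X q) {v : EuclideanSpace ℝ (Fin m)}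
    (h₁ : sqSumLT D.k v ≤ D.ε ^ 2) (h₂ : sqSumGE D.k v ≤ 4 * D.ε ^ 2) :
    ContinuousOn (fun s : ℝ => (D.chart.extend J).symm (D.chart.extend J q + s • v)) (Icc 0 1) := by
  refine (D.chart.continuousOn_extend_symm (I := J)).comp
    (continuous_const.add (continuous_id.smul continuous_const)).continuousOn fun s hs => ?_
  have hs2 : s ^ 2 ≤ 1 := by nlinarith [hs.1, hs.2]
  refine D.add_mem_target ?_ ?_
  · rw [sqSumLT_smul]; nlinarith [sqSumLT_nonneg D.k v, sq_nonneg s]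
  · rw [sqSumGE_smul]; nlinarith [sqSumGE_nonneg D.k v, sq_nonneg s]

end MilnorBox

/-! ### The obstruction set above a level is thin -/

section Cobordism

variable {n : ℕ} {M N : Type u} [TopologicalSpace M] [ChartedSpace (EuclideanSpace ℝ (Fin n)) M]
  [TopologicalSpace N] [ChartedSpace (EuclideanSpace ℝ (Fin n)) N]
  {c : Cobordism n M N} {f : c.W → ℝ} {ξ : Π x : c.W, TangentSpace (𝓡∂ (n + 1)) x}
  {a₀ a₁ : ℝ} {θ : ℝ × c.W → c.W}

namespace Cobordism.SlabFlow

open FourManifolds.Flow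

/-- **Milnor boxes for the cut-off field inside an open part of the slab**: about a critical
point `p` with `f p` in an open set `V ⊆ (a₀, a₁)` of values there is a Milnor box for
`(f, slabField)` whose chart domain is mapped into `V` by `f` (there the cut-off field is `ξ`,
which is gradient-like; `MilnorBoxDynamics.lean`). [cite: MilnorHCobordism1965, Def. 3.1 (2) (PDF p. 12)] -/
theorem exists_milnorBox (h : SlabFlow c f ξ a₀ a₁ θ) {V : Set ℝ} (hV : IsOpen V)
    (hVI : V ⊆ Ioo a₀ a₁) {p : c.W} (hp : IsMCriticalPt (𝓡∂ (n + 1)) f p) (hpV : f p ∈ V) :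
    ∃ D : MilnorBox (𝓡∂ (n + 1)) f (slabField f ξ a₀ a₁) p, D.chart.source ⊆ f ⁻¹' V := by
  have hint : (𝓡∂ (n + 1)).IsInteriorPoint p :=
    h.isInteriorPoint ⟨h.pos.trans (hVI hpV).1, (hVI hpV).2.trans h.lt_one⟩
  exact h.isGradientLike.exists_milnorBox_source_subset hp hint (hV.preimage h.contMDiff_f.continuous)
    hpV fun x hx => h.slabField_eq (Ioo_subset_Icc_self (hVI hx))

/-- The index `k` of a Milnor box about a critical point `p` of the slab determines the Morse
index: `index(p) = min (n + 1) k` (`MilnorChartIndex.lean`). [cite: MilnorHCobordism1965, Def. 3.1 (PDF p. 12)] -/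
theorem morseIndex_eq_min (h : SlabFlow c f ξ a₀ a₁ θ) {p : c.W}
    (D : MilnorBox (𝓡∂ (n + 1)) f (slabField f ξ a₀ a₁) p) (hfp : f p ∈ Ioo (0 : ℝ) 1) :
    morseIndex (𝓡∂ (n + 1)) f p = min (n + 1) D.k :=
  (isMCriticalPt_and_morseIndex_eq_of_eq_milnorQuadratic
    ((h.contMDiff_f.of_le (by norm_cast)).contMDiffAt) D.mem_maximalAtlas D.mem_source
    (h.isInteriorPoint hfp) D.apply_eq).2

/-- **The obstruction set above a regular level is thin** (Milnor, Def. 3.9: `D_R(p)` is a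
disc of dimension `n + 1 - λ`; here: a countable union of `C¹` images of open subsets of `ℝᵈ`,
`d ≥ n + 1 - λ`).  Let `b < r` be levels of the slab, `a₀ < b`, `r ≤ a₁`, `r` not a critical
value, and let every critical point `p` with `b < f p < r` have index `≥ e`, where
`n + 1 ≤ d + e`.  Then the set of points `x`, `b ≤ f x ≤ r`, lying on the unstable set of a
critical point `p` with `b < f p`, is covered by the images `θ(j, G_p(O_p))`, `j ∈ ℕ`, of the
local unstable discs of the finitely many such `p`: the backward flow line of `x` converges to
`p`, so it was in the Milnor box of `p` on the unstable disc at all sufficiently negative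
times, in particular at an integer time `-j`. [cite: MilnorHCobordism1965, Def. 3.9 (PDF p. 16), proof of Thm. 3.12 (PDF p. 18), Thm. 4.1 (PDF p. 22)] -/
theorem exists_thin_cover_obstruction (h : SlabFlow c f ξ a₀ a₁ θ) {b r : ℝ} (hb : a₀ < b)
    (hr : r ≤ a₁) (hreg : ∀ p, IsMCriticalPt (𝓡∂ (n + 1)) f p → f p ≠ r) {e d : ℕ}
    (hde : n + 1 ≤ d + e)
    (hidx : ∀ p, IsMCriticalPt (𝓡∂ (n + 1)) f p → b < f p → f p < r → e ≤ morseIndex (𝓡∂ (n + 1)) f p) :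
    ∃ (ι : Type u) (_ : Countable ι) (O : ι → Set (Fin d → ℝ)) (G : ι → (Fin d → ℝ) → c.W),
      (∀ j, IsOpen (O j)) ∧ (∀ j, ContMDiffOn 𝓘(ℝ, Fin d → ℝ) (𝓡∂ (n + 1)) 1 (G j) (O j)) ∧
      {x : c.W | f x ∈ Icc b r ∧ ∃ p, IsMCriticalPt (𝓡∂ (n + 1)) f p ∧ b < f p ∧
        x ∈ unstableSet (𝓡∂ (n + 1)) ξ p} ⊆ ⋃ j, G j '' O j := by
  classical
  -- the finitely many critical points strictly between the levels `b` and `r`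
  set P : Set c.W := {p | IsMCriticalPt (𝓡∂ (n + 1)) f p ∧ b < f p ∧ f p < r} with hP_def
  have hPfin : P.Finite := h.finite_criticalSet.subset fun p hp => hp.1
  haveI : Finite ↥P := hPfin.to_subtype
  -- Milnor boxes inside the open slab, and their unstable discs
  have hbox : ∀ p : ↥P, ∃ D : MilnorBox (𝓡∂ (n + 1)) f (slabField f ξ a₀ a₁) (p : c.W),
      D.chart.source ⊆ f ⁻¹' Ioo a₀ a₁ := fun p =>
    h.exists_milnorBox isOpen_Ioo Subset.rfl p.2.1 ⟨hb.trans p.2.2.1, p.2.2.2.trans_le hr⟩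
  choose D hD using hbox
  have hdk : ∀ p : ↥P, n + 1 ≤ d + (D p).k := by
    intro p
    have hmin := h.morseIndex_eq_min (D p)
      ⟨h.pos.trans (hb.trans p.2.2.1), (p.2.2.2.trans_le hr).trans h.lt_one⟩
    have he := hidx p p.2.1 p.2.2.1 p.2.2.2
    rw [hmin] at he
    rcases le_total (n + 1) (D p).k with h1 | h1
    · omega
    · rw [min_eq_right h1] at he; omega
  have hdisc : ∀ p : ↥P, ∃ (O : Set (Fin d → ℝ)) (G : (Fin d → ℝ) → c.W), IsOpen O ∧
      ContMDiffOn 𝓘(ℝ, Fin d → ℝ) (𝓡∂ (n + 1)) ∞ G O ∧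
      ∀ z ∈ (D p).chart.source, sqSumLT (D p).k ((D p).coord z) = 0 →
        sqSumGE (D p).k ((D p).coord z) < 4 * (D p).ε ^ 2 → z ∈ G '' O := fun p =>
    (D p).exists_smooth_param_unstableDisc (hdk p)
  choose O G hO hG hcov using hdisc
  refine ⟨ℕ × ↥P, inferInstance, fun jp => O jp.2, fun jp w => θ ((jp.1 : ℝ), G jp.2 w),
    fun jp => hO jp.2, fun jp => ?_, ?_⟩
  · exact ((h.isSmoothFlow.contMDiff_apply (jp.1 : ℝ)).comp_contMDiffOn (hG jp.2)).of_le
      (by exact_mod_cast le_top)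
  · rintro x ⟨hxI, p, hp, hbp, hxp⟩
    have hpx : f p ≤ f x := apply_le_of_mem_unstableSet h.mdifferentiable_f h.mlineDeriv_pos hxp
    have hpP : p ∈ P := ⟨hp, hbp, lt_of_le_of_ne (hpx.trans hxI.2) (hreg p hp)⟩
    set p' : ↥P := ⟨p, hpP⟩ with hp'
    have hflow : IsFlowOf (𝓡∂ (n + 1)) (slabField f ξ a₀ a₁) θ := h.isSmoothFlow.isFlowOf
    have hconv : Tendsto (fun t => θ (t, x)) atBot (𝓝 p) :=
      (h.mem_unstableSet_iff_tendsto (hxI.2.trans hr) (hb.le.trans hbp.le)).1 hxp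
    obtain ⟨T₀, hT₀, hT₀A⟩ := (D p').exists_mem_box_sqSumLT_eq_zero_of_tendsto_atBot hflow hconv
    have hconf := (D p').forall_mem_box_of_sqSumLT_eq_zero hflow hT₀ hT₀A
    -- an integer time `-j ≤ T₀`
    set j : ℕ := ⌈max 0 (-T₀)⌉₊ with hj_def
    have hj : -T₀ ≤ (j : ℝ) := (le_max_right 0 (-T₀)).trans (Nat.le_ceil _)
    set s : ℝ := -(j : ℝ) - T₀ with hs_def
    have hs : s ≤ 0 := by rw [hs_def]; linarith
    obtain ⟨hzbox, hzA, -⟩ := hconf s hs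
    have hz_eq : θ (s, θ (T₀, x)) = θ (-(j : ℝ), x) := by
      rw [h.isSmoothFlow.map_add]; congr 1; rw [hs_def]; ring
    rw [hz_eq] at hzbox hzA
    obtain ⟨w, hw, hGw⟩ := hcov p' _ hzbox.1 hzA hzbox.2.2
    refine mem_iUnion.2 ⟨(j, p'), w, hw, ?_⟩
    change θ ((j : ℝ), G p' w) = x
    rw [hGw, h.isSmoothFlow.map_add, add_neg_cancel, h.isSmoothFlow.map_zero]

/-! ### Every point of the slab is joined to the lower part -/

/-- **Every point of the slab is joined inside it to the part below the level `t₁`** (the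
path-connectedness input of "`V ∪ D_L` is a deformation retract of `W`", Thm. 3.14, here
through the flow).  Let `a₀ < lo ≤ t₁` and `t₂ ≤ a₁`, with `t₁`, `t₂` not critical values, and
suppose every critical point `p` with `t₁ < f p < t₂` has nonzero index (`t₁ < t₂`, or else
there is nothing to prove).  Then every `x` with
`lo ≤ f x ≤ t₂` is joined inside `S = f⁻¹[lo, t₂]` to a point of `A = f⁻¹[lo, t₁]`: points
off the unstable sets of the critical points above `t₁` flow down onto the level `t₁`; a point
on the unstable set of `p` is joined along its trajectory and a ray of the unstable disc to
`p`, and `p` along a ray of its stable disc (nonempty as the index is `≥ 1`) to a point strictly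
below `f p`, to which induction on the number of critical values `≤ f x` applies. [cite: MilnorHCobordism1965, Thm. 3.14 and Remark (PDF pp. 19–21), Def. 3.9 (PDF p. 16), proof of Thm. 3.12 (PDF p. 18)] -/
theorem exists_joinedIn_lowerSlab (h : SlabFlow c f ξ a₀ a₁ θ) {lo t₁ t₂ : ℝ} (hlo : a₀ < lo)
    (hlt : lo ≤ t₁) (ht₂ : t₂ ≤ a₁)
    (hreg : ∀ p, IsMCriticalPt (𝓡∂ (n + 1)) f p → f p ≠ t₁ ∧ f p ≠ t₂)
    (hidx : ∀ p, IsMCriticalPt (𝓡∂ (n + 1)) f p → f p ∈ Ioo t₁ t₂ → morseIndex (𝓡∂ (n + 1)) f p ≠ 0) :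
    ∀ x ∈ f ⁻¹' Icc lo t₂, ∃ a ∈ f ⁻¹' Icc lo t₁, JoinedIn (f ⁻¹' Icc lo t₂) x a := by
  classical
  set S : Set c.W := f ⁻¹' Icc lo t₂ with hS
  set A : Set c.W := f ⁻¹' Icc lo t₁ with hA
  have hflow : IsFlowOf (𝓡∂ (n + 1)) (slabField f ξ a₀ a₁) θ := h.isSmoothFlow.isFlowOf
  have hfc : Continuous f := h.contMDiff_f.continuous
  -- the critical points strictly between the levels, with Milnor boxes inside `f⁻¹(t₁, t₂)`
  set P : Set c.W := {p | IsMCriticalPt (𝓡∂ (n + 1)) f p ∧ f p ∈ Ioo t₁ t₂} with hP_def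
  have hPfin : P.Finite := h.finite_criticalSet.subset fun p hp => hp.1
  have hbox : ∀ p : ↥P, ∃ D : MilnorBox (𝓡∂ (n + 1)) f (slabField f ξ a₀ a₁) (p : c.W),
      D.chart.source ⊆ f ⁻¹' Ioo t₁ t₂ := fun p =>
    h.exists_milnorBox isOpen_Ioo (Ioo_subset_Ioo (hlo.le.trans hlt) ht₂) p.2.1 p.2.2
  choose D hD using hbox
  have hk : ∀ p : ↥P, 1 ≤ (D p).k := by
    intro p
    have hmin := h.morseIndex_eq_min (D p)
      ⟨h.pos.trans ((hlo.trans_le hlt).trans p.2.2.1), (p.2.2.2.trans_le ht₂).trans h.lt_one⟩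
    have hne := hidx p p.2.1 p.2.2
    rw [hmin] at hne
    by_contra hlt'
    push Not at hlt'
    have : (D p).k = 0 := by omega
    rw [this, Nat.min_zero] at hne
    exact hne rfl
  -- the number of critical values `≤ f x`
  set cnt : c.W → ℕ := fun x => (P ∩ {p | f p ≤ f x}).ncard with hcnt
  -- the inductive step
  have step : ∀ x ∈ S, (∀ w ∈ S, cnt w < cnt x → ∃ a ∈ A, JoinedIn S w a) →
      ∃ a ∈ A, JoinedIn S x a := by
    intro x hx ih
    by_cases hxt : f x ≤ t₁
    · exact ⟨x, ⟨hx.1, hxt⟩, JoinedIn.refl hx⟩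
    push Not at hxt
    by_cases hK : ∃ p, IsMCriticalPt (𝓡∂ (n + 1)) f p ∧ t₁ < f p ∧ x ∈ unstableSet (𝓡∂ (n + 1)) ξ p
    swap
    · -- flow down onto the level `t₁`
      push Not at hK
      have hhit : Hits θ f t₁ x := h.hits_of_forall_not_mem_unstableSet (hlo.trans_le hlt)
        (fun y hy hcy => (hreg y hcy).1 hy) ⟨hxt.le, hx.2.trans ht₂⟩ hK
      set τ := hittingTime θ f t₁ x with hτ
      have hγc : ContinuousOn (fun s : ℝ => θ (s * τ, x)) (Icc 0 1) :=
        (h.isSmoothFlow.continuous.comp ((continuous_id.mul continuous_const).prodMk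
          continuous_const)).continuousOn
      have hmem : ∀ s ∈ Icc (0 : ℝ) 1, θ (s * τ, x) ∈ S := by
        intro s hs
        have hm := h.apply_flow_mem_uIcc x τ hs
        rw [apply_hittingTime hhit, uIcc_of_ge hxt.le] at hm
        exact ⟨hlt.trans hm.1, hm.2.trans hx.2⟩
      have hj := joinedIn_of_continuousOn hγc hmem
      simp only [zero_mul, one_mul, h.isSmoothFlow.map_zero] at hj
      exact ⟨θ (τ, x), ⟨by rw [apply_hittingTime hhit]; exact hlt, by rw [apply_hittingTime hhit]⟩, hj⟩
    · obtain ⟨p, hp, ht₁p, hxp⟩ := hK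
      have hpx : f p ≤ f x := apply_le_of_mem_unstableSet h.mdifferentiable_f h.mlineDeriv_pos hxp
      have hpt₂ : f p < t₂ := lt_of_le_of_ne (hpx.trans hx.2) (hreg p hp).2
      have hpP : p ∈ P := ⟨hp, ht₁p, hpt₂⟩
      set p' : ↥P := ⟨p, hpP⟩ with hp'_def
      set Dp := D p' with hDp
      have hε := Dp.eps_pos
      have hsrc_val : ∀ z ∈ Dp.chart.source, f z ∈ Ioo t₁ t₂ := fun z hz => hD p' hz
      -- (1) `x` is joined along its trajectory to a point `z` of the unstable disc of `p`
      have hconv : Tendsto (fun t => θ (t, x)) atBot (𝓝 p) :=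
        (h.mem_unstableSet_iff_tendsto (hx.2.trans ht₂) ((hlo.le.trans hlt).trans ht₁p.le)).1 hxp
      obtain ⟨T₀, hT₀, hT₀A⟩ := Dp.exists_mem_box_sqSumLT_eq_zero_of_tendsto_atBot hflow hconv
      have hconf := Dp.forall_mem_box_of_sqSumLT_eq_zero hflow hT₀ hT₀A
      set T : ℝ := min T₀ 0 with hT_def
      have hT : T ≤ 0 := min_le_right _ _
      obtain ⟨hzbox, hzA, -⟩ := hconf (T - T₀) (by rw [hT_def]; linarith [min_le_left T₀ 0])
      have hz_eq : θ (T - T₀, θ (T₀, x)) = θ (T, x) := by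
        rw [h.isSmoothFlow.map_add]; congr 1; ring
      rw [hz_eq] at hzbox hzA
      set z := θ (T, x) with hz_def
      have hzx : f z ≤ f x := by
        have := h.monotone x hT
        simpa [h.isSmoothFlow.map_zero] using this
      have hzval : f z ∈ Ioo t₁ t₂ := hsrc_val z hzbox.1
      have hj₁ : JoinedIn S x z := by
        have hγc : ContinuousOn (fun s : ℝ => θ (s * T, x)) (Icc 0 1) :=
          (h.isSmoothFlow.continuous.comp ((continuous_id.mul continuous_const).prodMk
            continuous_const)).continuousOn
        have hmem : ∀ s ∈ Icc (0 : ℝ) 1, θ (s * T, x) ∈ S := by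
          intro s hs
          have hm := h.apply_flow_mem_uIcc x T hs
          rw [uIcc_of_ge hzx] at hm
          exact ⟨(hlt.trans hzval.1.le).trans hm.1, hm.2.trans hx.2⟩
        have hj := joinedIn_of_continuousOn hγc hmem
        simp only [zero_mul, one_mul, h.isSmoothFlow.map_zero] at hj
        exact hj
      -- (2) `z` is joined to `p` along a ray of the unstable disc
      set v := Dp.coord z with hv_def
      have hv₁ : sqSumLT Dp.k v ≤ Dp.ε ^ 2 := by rw [hzA]; positivity
      have hv₂ : sqSumGE Dp.k v ≤ 4 * Dp.ε ^ 2 := hzbox.2.2.le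
      have hj₂ : JoinedIn S p z := by
        have hray := Dp.continuousOn_symm_add_smul hv₁ hv₂
        have hmem : ∀ s ∈ Icc (0 : ℝ) 1,
            (Dp.chart.extend (𝓡∂ (n + 1))).symm (Dp.chart.extend (𝓡∂ (n + 1)) p + s • v) ∈ S := by
          intro s hs
          obtain ⟨hsrc, -⟩ := Dp.apply_symm_add_smul hv₁ hv₂ hs
          have := hsrc_val _ hsrc
          exact ⟨hlt.trans this.1.le, this.2.le⟩
        have hj := joinedIn_of_continuousOn hray hmem
        simp only [zero_smul, one_smul] at hj
        rwa [Dp.symm_add_zero, hv_def, Dp.symm_add_coord hzbox.1] at hj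
      -- (3) `p` is joined along a ray of the stable disc to a point `w` strictly below it
      have hn : 0 < n + 1 := Nat.succ_pos n
      set u : EuclideanSpace ℝ (Fin (n + 1)) := WithLp.toLp 2 fun i : Fin (n + 1) =>
        if (i : ℕ) = 0 then Dp.ε / 2 else 0 with hu_def
      have hu_apply : ∀ i : Fin (n + 1), u i = if (i : ℕ) = 0 then Dp.ε / 2 else 0 := fun i => rfl
      have huA : sqSumLT Dp.k u = (Dp.ε / 2) ^ 2 := by
        rw [sqSumLT, Finset.sum_eq_single (⟨0, hn⟩ : Fin (n + 1))]
        · simp [hu_apply]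
        · intro i _ hi
          have : (i : ℕ) ≠ 0 := fun h0 => hi (Fin.ext h0)
          simp [hu_apply, this]
        · intro habs
          have hk0 : ((⟨0, hn⟩ : Fin (n + 1)) : ℕ) < Dp.k := hk p'
          exact absurd (Finset.mem_filter.2 ⟨Finset.mem_univ (⟨0, hn⟩ : Fin (n + 1)), hk0⟩) habs
      have huB : sqSumGE Dp.k u = 0 := by
        refine Finset.sum_eq_zero fun i hi => ?_
        have hki : Dp.k ≤ (i : ℕ) := (Finset.mem_filter.1 hi).2
        have hk1 : 1 ≤ Dp.k := hk p'
        have : (i : ℕ) ≠ 0 := by omega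
        simp [hu_apply, this]
      have hu₁ : sqSumLT Dp.k u ≤ Dp.ε ^ 2 := by rw [huA]; nlinarith
      have hu₂ : sqSumGE Dp.k u ≤ 4 * Dp.ε ^ 2 := by rw [huB]; positivity
      set w := (Dp.chart.extend (𝓡∂ (n + 1))).symm (Dp.chart.extend (𝓡∂ (n + 1)) p + (1 : ℝ) • u)
        with hw_def
      obtain ⟨hwsrc, hfw⟩ := Dp.apply_symm_add_smul hu₁ hu₂ (s := 1) ⟨zero_le_one, le_rfl⟩
      have hwval : f w ∈ Ioo t₁ t₂ := hsrc_val w hwsrc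
      have hfw' : f w = f p - (Dp.ε / 2) ^ 2 := by rw [hw_def, hfw, huA, huB]; ring
      have hwp : f w < f p := by rw [hfw']; nlinarith
      have hj₃ : JoinedIn S p w := by
        have hray := Dp.continuousOn_symm_add_smul hu₁ hu₂
        have hmem : ∀ s ∈ Icc (0 : ℝ) 1,
            (Dp.chart.extend (𝓡∂ (n + 1))).symm (Dp.chart.extend (𝓡∂ (n + 1)) p + s • u) ∈ S := by
          intro s hs
          obtain ⟨hsrc, -⟩ := Dp.apply_symm_add_smul hu₁ hu₂ hs
          have := hsrc_val _ hsrc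
          exact ⟨hlt.trans this.1.le, this.2.le⟩
        have hj := joinedIn_of_continuousOn hray hmem
        simp only [zero_smul] at hj
        rwa [Dp.symm_add_zero] at hj
      -- (4) induction: fewer critical values lie below `w`
      have hwS : w ∈ S := ⟨hlt.trans hwval.1.le, hwval.2.le⟩
      have hlt_cnt : cnt w < cnt x := by
        refine Set.ncard_lt_ncard ?_ (hPfin.subset inter_subset_left)
        refine ⟨fun y hy => ⟨hy.1, hy.2.trans (hwp.le.trans hpx)⟩, fun hsub => ?_⟩
        have : p ∈ P ∩ {y | f y ≤ f w} := hsub ⟨hpP, hpx⟩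
        exact absurd this.2 (not_le.2 hwp)
      obtain ⟨a, ha, hwa⟩ := ih w hwS hlt_cnt
      exact ⟨a, ha, ((hj₁.trans hj₂.symm).trans hj₃).trans hwa⟩
  -- induction on the number of critical values below the point
  suffices key : ∀ N : ℕ, ∀ x ∈ S, cnt x ≤ N → ∃ a ∈ A, JoinedIn S x a from
    fun x hx => key (cnt x) x hx le_rfl
  intro N
  induction N with
  | zero =>
    intro x hx h0
    exact step x hx fun w _ hlt' => by omega
  | succ N ih =>
    intro x hx hle
    exact step x hx fun w hw hlt' => ih w hw (by omega)

end Cobordism.SlabFlow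

end Cobordism

end Literature.Topology.FourManifolds
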